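import Summits.Ventures.YMGap.Thresholds.TruncatedSplit
import HarnessLib

/-!
# Venture YMGap — C-SMOOTH (i): TREE DECAY OF THE TRUNCATED FUNCTIONS OF EVERY ORDER of the `SU(2)`, `d = 4`
# strong-coupling state, with constants uniform in the coupling `0 ≤ β_W ≤ β₁ ≤ 9/25`

HONEST FRAMING: venture file of the cell `pub-ymgap` (QuantumFields programme), seat ds-1 (gen 12).  Strong-coupling
LATTICE statements for `SU(2)` lattice Yang–Mills on `ℤ^4` with the Wilson action inside the one-sided vertex-star
window `0 ≤ β_W ≤ 9/25` (tree bare coupling `β_W/2`, `W_q = ½ Re tr U_q`); cumulant estimates of the unique DLR state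
only; nothing about the continuum, confinement at weak coupling, or the Clay problem.  Domination input of the sibling
file `CouplingSmooth` (the state and the free energy are `C^∞` in the coupling).

For `β₁ ≤ 9/25`, a Lipschitz cylinder `F` (support `Λ`, constant `K`, links within sup-distance `D` of `x₀`), the DLR
state `μ` at ANY `0 ≤ β_W ≤ β₁`, `n` plaquettes `q : Fin n → ZdPlaquette 4`, and the truncated function
`u_{n+1}(F; W_{q 0}; …; W_{q (n−1)}) = trunc μ F W q` (anchored cumulant, `CumulantRecursion` / `CumulantCalculus`):
(inputs from the sibling `TruncatedSplit`: the pigeonhole cut `exists_gap`, the slot data `su2_slot_data`, and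
the one-split estimate `su2_abs_mom_sub_mom_mul_mom_le`):
* ★★ `su2_exists_truncated_tree_bound` — TREE DECAY, ONE CONSTANT FOR THE WINDOW: there are `A ≥ 0` and
  `0 ≤ ρ < 1` (depending on `n, β₁` and the data of `F` only) with
  `|u_{n+1}(F; W_{q 0}; …; W_{q (n−1)})| ≤ A · ∏_i ρ^{‖x₀ − x_{q i}‖₁}` for every `0 ≤ β_W ≤ β₁`, every DLR state
  at `β_W` and every `q` (split lemma `abs_ac_le_of_split` at the pigeonhole cut, `e^{−κR/n} ≤ ∏_i e^{−κ d_i/n²}`);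
* ★ `su2_summable_truncated` — hence `q ↦ u_{n+1}(F; W_q…)` is absolutely summable over `(ZdPlaquette 4)^n` with
  `Σ' |u_{n+1}| ≤ A Zⁿ`, and `su2_tsum_abs_truncated_snoc_le` — the fibre sums `Σ_r |u_{n+2}(F; W_q…; W_r)|` are
  dominated by a summable product in `q` (the domination that differentiates the series termwise, file `CouplingSmooth`).

References (mechanism only): M. Duneau, D. Iagolnitzer, B. Souillard, CMP 31 (1973) 191 and CMP 35 (1974) 307 (tree
decay of truncated functions from clustering); B. Simon, *The Statistical Mechanics of Lattice Gases* I (1993), §II.12;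
R. L. Dobrushin, S. B. Shlosman (1985/87).
-/

noncomputable section

open MeasureTheory ProbabilityTheory Function Finset Filter Topology Real Set
open scoped NNReal
open Literature.MathematicalPhysics.QuantumLattice (LGConfig ZdEdge ZdPlaquette plaquetteEdges fundamentalRep
  fundamentalRep_mem_unitaryGroup ymGibbsMeasures)
open Literature.MathematicalPhysics.QuantumFieldTheory hiding ZdEdge
open Literature.Probability.LatticeModels (Site Site.supNorm Site.norm_eq_supNorm Site.supNorm_eq_zero_iff)
open Summit.Ventures.YMGap.DSWindow (starRate starRate_pos)
open Summit.Ventures.YMGap.StarWindowGauge (gaugeR gaugeR_lt_one_of_le)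
open Summit.Ventures.YMGap.StarLemmaG (gaugeR_nonneg)
open Summit.Ventures.YMGap.RobustBall (l1 numOrient)
open Summit.Ventures.YMGap.LinearResponseBound (summable_and_tsum_base_le)
open Summit.Ventures.YMGap.PlaquetteSusceptibility (l1_le_mul_norm)
open Summit.Ventures.YMGap.Cumulants

namespace Summit.Ventures.YMGap.CouplingResponse

/-- Local shorthand: the normalised plaquette observable `W_q = ½ Re tr U_q` of `SU(2)` on `ℤ⁴`, as a family. -/
local notation3 (prettyPrint := false) "𝓦" =>
  fun q : ZdPlaquette 4 => zdPlaquetteObs (d := 4) (fundamentalRep (Fin 2)) (Prod.fst q) (Prod.snd q).1.1 (Prod.snd q).1.2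

/-! ### §1 Tree decay of the truncated functions of every order -/

set_option maxHeartbeats 400000 in
/-- ★★ **TREE DECAY OF THE TRUNCATED FUNCTIONS OF EVERY ORDER, ONE CONSTANT FOR THE WINDOW** (`SU(2)`, `d = 4`,
hypothesis-free).  For `β₁ ≤ 9/25`, a Lipschitz cylinder `F` (support `Λ`, constant `K`, links within `D` of `x₀`)
and every order `n` there are `A ≥ 0` and `0 ≤ ρ < 1` such that for EVERY `0 ≤ β_W ≤ β₁`, every DLR state `μ` at
`β_W` and every `n`-tuple of plaquettes `q`:
`|u_{n+1}(F; W_{q 0}; …; W_{q (n−1)})_μ| ≤ A · ∏_i ρ^{‖x₀ − x_{q i}‖₁}`.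
Proof: the split lemma `abs_ac_le_of_split` at the pigeonhole cut `exists_gap` (gap `g ≥ R/n`,
`R = max_i ‖x_{q i} − x₀‖_∞`) with the one-split estimate `su2_abs_mom_sub_mom_mul_mom_le`, and
`e^{−κ g} ≤ ∏_i e^{−κ‖x_{q i} − x₀‖₁/(4(n+1)²)}`; explicitly `ρ = exp(−κ/(4(n+1)²))`, `κ = starRate (R_G β₁)`, and
`A = cumBound(n+1) B₀^{n+1} (1 + 4(2√2)² e^{κ(2D+6)} ((n+1)² (#Λ+4)(K+32) B₀^{n+1})²)`, `B₀ = |F 1| + 2K + 1`. -/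
theorem su2_exists_truncated_tree_bound {β₁ : ℝ} (h1 : β₁ ≤ 9 / 25)
    {F : LGConfig 4 (Matrix.specialUnitaryGroup (Fin 2) ℂ) → ℝ} {Λ : Finset (ZdEdge 4)} {K : ℝ≥0}
    (hF : IsLipschitzCylinder (fundamentalRep (Fin 2)) F Λ K)
    {x₀ : Site 4} {D : ℕ} (hD : ∀ e ∈ Λ, ‖e.1 - x₀‖ ≤ D) (n : ℕ) :
    ∃ A ρ : ℝ, 0 ≤ A ∧ 0 ≤ ρ ∧ ρ < 1 ∧ ∀ ⦃βW : ℝ⦄, 0 ≤ βW → βW ≤ β₁ →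
      ∀ ⦃μ : Measure (LGConfig 4 (Matrix.specialUnitaryGroup (Fin 2) ℂ))⦄,
        μ ∈ ymGibbsMeasures (d := 4) (fundamentalRep (Fin 2)) (2 * (βW / 4)) →
      ∀ q : Fin n → ZdPlaquette 4, |trunc μ F 𝓦 q| ≤ A * ∏ i, ρ ^ l1 (x₀ - (q i).1) := by
  classical
  rcases lt_or_ge β₁ 0 with hneg | hβ₁0
  · exact ⟨0, 0, le_rfl, le_rfl, zero_lt_one, fun βW h0 hβ => absurd (h0.trans hβ) (not_le.2 hneg)⟩
  have hκ : 0 < starRate (gaugeR β₁) :=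
    starRate_pos (gaugeR_nonneg hβ₁0 (by linarith)) (gaugeR_lt_one_of_le hβ₁0 h1)
  set κ := starRate (gaugeR β₁) with hκdef
  set K₀ : ℝ≥0 := K + 4 * 2 ^ 3 with hK₀
  set B₀ : ℝ≥0 := ‖F 1‖₊ + 2 * K + 1 with hB₀
  set c₀ : ℕ := Λ.card + 4 with hc₀
  set D' : ℕ := D + 1 with hD'
  have hB1 : (1 : ℝ≥0) ≤ B₀ := by rw [hB₀]; exact le_add_self
  have hB1r : (1 : ℝ) ≤ B₀ := by exact_mod_cast hB1
  set C₀ : ℝ := 4 * (2 * Real.sqrt 2) ^ 2 with hC₀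
  set Q : ℝ := (((n + 1 : ℕ) : ℝ) ^ 2 * c₀ * K₀ * (B₀ : ℝ) ^ (n + 1)) ^ 2 with hQ
  set A : ℝ := cumBound (n + 1) * (B₀ : ℝ) ^ (n + 1) *
    (1 + C₀ * Real.exp (κ * (((2 * D' : ℕ) : ℝ) + 4)) * Q) with hA
  set ρ : ℝ := Real.exp (-(κ / (4 * ((n : ℝ) + 1) ^ 2))) with hρ
  have hρ0 : 0 ≤ ρ := (Real.exp_pos _).le
  have hc4 : 0 < κ / (4 * ((n : ℝ) + 1) ^ 2) := by positivity
  have hρ1 : ρ < 1 := Real.exp_lt_one_iff.2 (by linarith)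
  have hQ0 : 0 ≤ Q := by positivity
  have hcb := (cumBound_pos (n + 1)).le
  have hA0 : 0 ≤ A := by positivity
  refine ⟨A, ρ, hA0, hρ0, hρ1, fun βW h0 hβ μ hμ q => ?_⟩
  haveI : IsProbabilityMeasure μ := hμ.1
  -- slot data
  choose Λs cs hL hM hc hnear hcs0 hcsq using su2_slot_data hF hD q
  set S : Finset ℕ := Finset.range (n + 1) with hS
  have hcard : S.card = n + 1 := by rw [hS, Finset.card_range]
  have hmomb : ∀ T ⊆ S, |mom μ (slots F 𝓦 q) T| ≤ ∏ _i ∈ T, (B₀ : ℝ) :=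
    abs_mom_le μ (b := fun _ => (B₀ : ℝ)) (fun i _ U => hM i U)
  have hmom1 : mom μ (slots F 𝓦 q) ∅ = 1 := mom_empty μ _
  have hprodS : ∏ _i ∈ S, (B₀ : ℝ) = (B₀ : ℝ) ^ (n + 1) := by rw [Finset.prod_const, hcard]
  -- the crude bound, valid always
  have hcrude : |trunc μ F 𝓦 q| ≤ cumBound (n + 1) * (B₀ : ℝ) ^ (n + 1) := by
    have h := abs_ac_le (b := fun _ => (B₀ : ℝ)) (fun _ => B₀.2) hmomb 0 (subset_rfl : S ⊆ S)
    rw [hprodS, hcard] at h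
    exact h
  -- distances of the plaquettes from `x₀`
  set d : Fin n → ℕ := fun i => Site.supNorm ((q i).1 - x₀) with hd
  have hl1 : ∀ i, (l1 (x₀ - (q i).1) : ℝ) ≤ 4 * d i := fun i => by
    have h := l1_le_mul_norm (d := 4) (x₀ - (q i).1)
    rw [norm_sub_rev, Site.norm_eq_supNorm] at h
    exact_mod_cast h
  have hprod0 : 0 ≤ ∏ i, ρ ^ l1 (x₀ - (q i).1) := Finset.prod_nonneg fun i _ => pow_nonneg hρ0 _
  have hAge : cumBound (n + 1) * (B₀ : ℝ) ^ (n + 1) ≤ A := by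
    rw [hA]
    exact le_mul_of_one_le_right (by positivity) (le_add_of_nonneg_right (by positivity))
  by_cases hR0 : ∀ i, d i = 0
  · -- all plaquettes at `x₀`: the crude bound is the claim
    have hone : ∏ i, ρ ^ l1 (x₀ - (q i).1) = 1 := by
      refine Finset.prod_eq_one fun i _ => ?_
      have h' : (l1 (x₀ - (q i).1) : ℝ) ≤ 0 := by simpa [hR0 i] using hl1 i
      have h'' : l1 (x₀ - (q i).1) = 0 := Nat.le_zero.1 (by exact_mod_cast h')
      rw [h'', pow_zero]
    rw [hone, mul_one]
    exact hcrude.trans hAge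
  · -- a plaquette away from `x₀`: pigeonhole cut
    obtain ⟨i₁, hi₁⟩ := not_forall.1 hR0
    have hne : (Finset.univ : Finset (Fin n)).Nonempty := ⟨i₁, Finset.mem_univ _⟩
    set R : ℕ := Finset.univ.sup d with hRdef
    have hdR : ∀ i, d i ≤ R := fun i => Finset.le_sup (f := d) (Finset.mem_univ i)
    obtain ⟨i₀, -, hi₀⟩ := Finset.exists_mem_eq_sup Finset.univ hne d
    have hRpos : 0 < R := by
      have := hdR i₁; omega
    obtain ⟨u, v, huv, hvR, hgap, hall⟩ := exists_gap d hdR ⟨i₀, hi₀.symm⟩ hRpos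
    -- the cut: LOW = slots whose centre is within `u` of `x₀`
    let p : ℕ → Prop := fun i => Site.supNorm (cs i - x₀) ≤ u
    have hp0 : p 0 := by
      show Site.supNorm (cs 0 - x₀) ≤ u
      rw [hcs0 0 rfl, sub_self]
      have : Site.supNorm (0 : Site 4) = 0 := Site.supNorm_eq_zero_iff.2 rfl
      omega
    have hhigh : ∀ j ∈ S, ¬p j → (v : ℝ) ≤ ‖cs j - x₀‖ := by
      intro j hj hpj
      have hjn : j < n + 1 := Finset.mem_range.1 hj
      rcases j with _ | j'
      · exact absurd hp0 hpj
      · have hj' : j' < n := by omega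
        have e := hcsq (j' + 1) ⟨j', hj'⟩ rfl
        have hdj : ¬(d ⟨j', hj'⟩ ≤ u) := by
          intro h; apply hpj; show Site.supNorm (cs (j' + 1) - x₀) ≤ u; rw [e]; exact h
        have hv : v ≤ d ⟨j', hj'⟩ := (hall ⟨j', hj'⟩).resolve_left hdj
        rw [e, Site.norm_eq_supNorm]
        exact_mod_cast hv
    have hsep : ∀ i ∈ S, ∀ j ∈ S, p i → ¬p j → (((v - u : ℕ) : ℕ) : ℝ) ≤ ‖cs i - cs j‖ := by
      intro i hi j hj hpi hpj
      have hlow : ‖cs i - x₀‖ ≤ u := by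
        rw [Site.norm_eq_supNorm]; exact_mod_cast (show Site.supNorm (cs i - x₀) ≤ u from hpi)
      have hv := hhigh j hj hpj
      have htri : ‖cs j - x₀‖ ≤ ‖cs i - cs j‖ + ‖cs i - x₀‖ := by
        calc ‖cs j - x₀‖ = ‖(cs i - x₀) - (cs i - cs j)‖ := by congr 1; abel
          _ ≤ ‖cs i - x₀‖ + ‖cs i - cs j‖ := norm_sub_le _ _
          _ = _ := add_comm _ _
      rw [Nat.cast_sub huv.le]
      linarith
    have hsplit := su2_abs_mom_sub_mom_mul_mom_le h1 h0 hβ hμ (S := S) hB1 (fun i _ => hL i) (fun i _ => hM i)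
      (fun i _ => hc i) (fun i _ => hnear i) p hsep
    -- both sides of the cut are occupied, the anchor is LOW
    have h0S : (0 : ℕ) ∈ S := Finset.mem_range.2 (Nat.succ_pos n)
    have hSp : (S.filter p).Nonempty := ⟨0, Finset.mem_filter.2 ⟨h0S, hp0⟩⟩
    have hSn : (S.filter fun i => ¬p i).Nonempty := by
      refine ⟨i₀.1 + 1, Finset.mem_filter.2 ⟨Finset.mem_range.2 (by have := i₀.2; omega), fun hp => ?_⟩⟩
      have e := hcsq (i₀.1 + 1) i₀ rfl
      have hp' : Site.supNorm (cs (i₀.1 + 1) - x₀) ≤ u := hp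
      rw [e] at hp'
      have : d i₀ ≤ u := hp'
      omega
    set ε : ℝ := 4 * (2 * Real.sqrt 2) ^ 2 *
      Real.exp (-(starRate (gaugeR β₁) * ((((v - u : ℕ) - (2 * D' + 2) : ℕ) - 2 : ℕ) : ℝ))) *
      (((S.card : ℝ) ^ 2 * c₀ * K₀ * (B₀ : ℝ) ^ S.card) ^ 2) with hε
    have hε0 : 0 ≤ ε := by positivity
    have key := abs_ac_le_of_split p (b := fun _ => (B₀ : ℝ)) (fun _ => B₀.2) hε0 hmom1 hmomb hsplit h0S hSp hSn
    have htr : trunc μ F 𝓦 q = ac (mom μ (slots F 𝓦 q)) 0 S := rfl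
    rw [htr]
    refine key.trans ?_
    rw [hprodS, hcard]
    -- exponent bookkeeping: `e^{-κ((g-(2D'+2))-2)} ≤ e^{κ(2D'+4)} e^{-κ g} ≤ e^{κ(2D'+4)} ∏ ρ^{l1}`
    have hexp1 := exp_trunc_sub_le hκ.le (v - u) (2 * D')
    have hsuml1 : ∑ i, (l1 (x₀ - (q i).1) : ℝ) ≤ 4 * ((n : ℝ) + 1) ^ 2 * ((v - u : ℕ) : ℝ) := by
      have hg : (R : ℝ) ≤ n * ((v - u : ℕ) : ℝ) := by exact_mod_cast hgap
      calc ∑ i, (l1 (x₀ - (q i).1) : ℝ) ≤ ∑ _i : Fin n, (4 * R : ℝ) :=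
            Finset.sum_le_sum fun i _ => (hl1 i).trans
              (mul_le_mul_of_nonneg_left (by exact_mod_cast hdR i) (by norm_num))
        _ = n * (4 * R) := by rw [Finset.sum_const, Finset.card_univ, Fintype.card_fin, nsmul_eq_mul]
        _ ≤ n * (4 * (n * ((v - u : ℕ) : ℝ))) := by gcongr
        _ ≤ 4 * ((n : ℝ) + 1) ^ 2 * ((v - u : ℕ) : ℝ) := by
            have : (0 : ℝ) ≤ ((v - u : ℕ) : ℝ) := Nat.cast_nonneg _
            nlinarith
    have hexp2 : Real.exp (-(κ * ((v - u : ℕ) : ℝ))) ≤ ∏ i, ρ ^ l1 (x₀ - (q i).1) := by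
      rw [hρ, prod_exp_neg_pow_eq]
      refine Real.exp_le_exp.2 (neg_le_neg ?_)
      calc κ / (4 * ((n : ℝ) + 1) ^ 2) * ∑ i, (l1 (x₀ - (q i).1) : ℝ)
          ≤ κ / (4 * ((n : ℝ) + 1) ^ 2) * (4 * ((n : ℝ) + 1) ^ 2 * ((v - u : ℕ) : ℝ)) :=
            mul_le_mul_of_nonneg_left hsuml1 hc4.le
        _ = κ * ((v - u : ℕ) : ℝ) := by field_simp
    calc cumBound (n + 1) * ε * (B₀ : ℝ) ^ (n + 1)
        = cumBound (n + 1) * (B₀ : ℝ) ^ (n + 1) * (C₀ * Q) *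
            Real.exp (-(κ * ((((v - u : ℕ) - (2 * D' + 2) : ℕ) - 2 : ℕ) : ℝ))) := by
          rw [hε, hQ, hC₀, hcard, ← hκdef]; ring
      _ ≤ cumBound (n + 1) * (B₀ : ℝ) ^ (n + 1) * (C₀ * Q) *
            (Real.exp (κ * (((2 * D' : ℕ) : ℝ) + 4)) * Real.exp (-(κ * ((v - u : ℕ) : ℝ)))) :=
          mul_le_mul_of_nonneg_left hexp1 (by positivity)
      _ ≤ cumBound (n + 1) * (B₀ : ℝ) ^ (n + 1) * (C₀ * Q) *
            (Real.exp (κ * (((2 * D' : ℕ) : ℝ) + 4)) * ∏ i, ρ ^ l1 (x₀ - (q i).1)) := by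
          gcongr
      _ = cumBound (n + 1) * (B₀ : ℝ) ^ (n + 1) * (C₀ * Real.exp (κ * (((2 * D' : ℕ) : ℝ) + 4)) * Q) *
            ∏ i, ρ ^ l1 (x₀ - (q i).1) := by ring
      _ ≤ A * ∏ i, ρ ^ l1 (x₀ - (q i).1) := by
          refine mul_le_mul_of_nonneg_right ?_ hprod0
          rw [hA]
          refine mul_le_mul_of_nonneg_left (le_add_of_nonneg_left zero_le_one) (by positivity)

/-! ### §2 Absolute summability over plaquette tuples; the fibre domination -/

/-- ★ **ABSOLUTE SUMMABILITY OF THE TRUNCATED FUNCTIONS OF EVERY ORDER over all plaquette tuples** (`SU(2)`,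
`d = 4`, hypothesis-free): with the constants `A, ρ` of `su2_exists_truncated_tree_bound` and
`Z = D₄((1+ρ)/(1−ρ))⁴`, for every `0 ≤ β_W ≤ β₁ ≤ 9/25` and every DLR state `μ` at `β_W`,
`q ↦ u_{n+1}(F; W_{q 0}; …; W_{q (n−1)})_μ` is summable over `(ZdPlaquette 4)^n` and `Σ'_q |u_{n+1}| ≤ A Zⁿ` — the
`n`-th order static response of every local observable is FINITE on the window, uniformly in the coupling. -/
theorem su2_summable_truncated {β₁ : ℝ} (h1 : β₁ ≤ 9 / 25)
    {F : LGConfig 4 (Matrix.specialUnitaryGroup (Fin 2) ℂ) → ℝ} {Λ : Finset (ZdEdge 4)} {K : ℝ≥0}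
    (hF : IsLipschitzCylinder (fundamentalRep (Fin 2)) F Λ K)
    {x₀ : Site 4} {D : ℕ} (hD : ∀ e ∈ Λ, ‖e.1 - x₀‖ ≤ D) (n : ℕ) :
    ∃ A ρ : ℝ, 0 ≤ A ∧ 0 ≤ ρ ∧ ρ < 1 ∧ ∀ ⦃βW : ℝ⦄, 0 ≤ βW → βW ≤ β₁ →
      ∀ ⦃μ : Measure (LGConfig 4 (Matrix.specialUnitaryGroup (Fin 2) ℂ))⦄,
        μ ∈ ymGibbsMeasures (d := 4) (fundamentalRep (Fin 2)) (2 * (βW / 4)) →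
      (∀ q : Fin n → ZdPlaquette 4, |trunc μ F 𝓦 q| ≤ A * ∏ i, ρ ^ l1 (x₀ - (q i).1)) ∧
      Summable (fun q : Fin n → ZdPlaquette 4 => trunc μ F 𝓦 q) ∧
      ∑' q : Fin n → ZdPlaquette 4, |trunc μ F 𝓦 q| ≤ A * (numOrient 4 * ((1 + ρ) / (1 - ρ)) ^ 4) ^ n := by
  classical
  obtain ⟨A, ρ, hA0, hρ0, hρ1, h⟩ := su2_exists_truncated_tree_bound h1 hF hD n
  refine ⟨A, ρ, hA0, hρ0, hρ1, fun βW h0 hβ μ hμ => ⟨h h0 hβ hμ, ?_⟩⟩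
  exact summable_pi_of_abs_le_prod hA0 (fun r => pow_nonneg hρ0 _) (sum_pow_l1_plaquette_le hρ0 hρ1 x₀)
    (h h0 hβ hμ)

/-- ★ **THE FIBRE DOMINATION** (`SU(2)`, `d = 4`): with the order-`(n+1)` constants `A, ρ` and `Z = D₄((1+ρ)/(1−ρ))⁴`,
for every `0 ≤ β_W ≤ β₁ ≤ 9/25`, every DLR state `μ` at `β_W` and every `q : Fin n → ZdPlaquette 4`, the fibre
`r ↦ u_{n+2}(F; W_{q 0}; …; W_{q (n−1)}; W_r)_μ` is summable with
`Σ'_r |u_{n+2}(…; W_r)| ≤ A Z ∏_i ρ^{‖x₀ − x_{q i}‖₁}` — a bound summable in `q`, uniform in the coupling: the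
domination under which the order-`n` response series is differentiated termwise (file `CouplingSmooth`). -/
theorem su2_tsum_abs_truncated_snoc_le {β₁ : ℝ} (h1 : β₁ ≤ 9 / 25)
    {F : LGConfig 4 (Matrix.specialUnitaryGroup (Fin 2) ℂ) → ℝ} {Λ : Finset (ZdEdge 4)} {K : ℝ≥0}
    (hF : IsLipschitzCylinder (fundamentalRep (Fin 2)) F Λ K)
    {x₀ : Site 4} {D : ℕ} (hD : ∀ e ∈ Λ, ‖e.1 - x₀‖ ≤ D) (n : ℕ) :
    ∃ A ρ : ℝ, 0 ≤ A ∧ 0 ≤ ρ ∧ ρ < 1 ∧ ∀ ⦃βW : ℝ⦄, 0 ≤ βW → βW ≤ β₁ →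
      ∀ ⦃μ : Measure (LGConfig 4 (Matrix.specialUnitaryGroup (Fin 2) ℂ))⦄,
        μ ∈ ymGibbsMeasures (d := 4) (fundamentalRep (Fin 2)) (2 * (βW / 4)) →
      ∀ q : Fin n → ZdPlaquette 4,
        Summable (fun r : ZdPlaquette 4 => trunc μ F 𝓦 (Fin.snoc q r : Fin (n + 1) → ZdPlaquette 4)) ∧
        ∑' r : ZdPlaquette 4, |trunc μ F 𝓦 (Fin.snoc q r : Fin (n + 1) → ZdPlaquette 4)| ≤
          A * (numOrient 4 * ((1 + ρ) / (1 - ρ)) ^ 4) * ∏ i, ρ ^ l1 (x₀ - (q i).1) := by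
  classical
  obtain ⟨A, ρ, hA0, hρ0, hρ1, h⟩ := su2_exists_truncated_tree_bound h1 hF hD (n + 1)
  refine ⟨A, ρ, hA0, hρ0, hρ1, fun βW h0 hβ μ hμ q => ?_⟩
  set c : ℝ := A * ∏ i, ρ ^ l1 (x₀ - (q i).1) with hc
  have hc0 : 0 ≤ c := mul_nonneg hA0 (Finset.prod_nonneg fun i _ => pow_nonneg hρ0 _)
  have hpt : ∀ r : ZdPlaquette 4,
      |trunc μ F 𝓦 (Fin.snoc q r : Fin (n + 1) → ZdPlaquette 4)| ≤ c * ρ ^ l1 (x₀ - r.1) := by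
    intro r
    have hb := h h0 hβ hμ (Fin.snoc q r)
    rw [Fin.prod_univ_castSucc] at hb
    simp only [Fin.snoc_castSucc, Fin.snoc_last] at hb
    rw [hc, mul_assoc]
    exact hb
  obtain ⟨hs, hle⟩ := summable_and_tsum_base_le (d := 4) hc0 hρ0 hρ1 x₀
  have hsum : Summable fun r : ZdPlaquette 4 =>
      |trunc μ F 𝓦 (Fin.snoc q r : Fin (n + 1) → ZdPlaquette 4)| :=
    Summable.of_nonneg_of_le (fun r => abs_nonneg _) hpt hs
  refine ⟨hsum.of_abs, (hsum.tsum_le_tsum hpt hs).trans ?_⟩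
  calc ∑' r : ZdPlaquette 4, c * ρ ^ l1 (x₀ - r.1) ≤ c * (numOrient 4 * ((1 + ρ) / (1 - ρ)) ^ 4) := hle
    _ = A * (numOrient 4 * ((1 + ρ) / (1 - ρ)) ^ 4) * ∏ i, ρ ^ l1 (x₀ - (q i).1) := by rw [hc]; ring

end Summit.Ventures.YMGap.CouplingResponse

end
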